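import Summits.QuantumFields.YangMills.Theses.BoundedSkewnessRunning

/-!
# The companion-free form of K2 and what a refutation must exhibit (negative-side lemmas)

For `BoundedSkewnessRunning.SkewnessNonGeneration` (K2, item `stmt-QuantumFields-19896`):
modulo the route's other crux K1 (`UVSkewnessExtinction`) K2 is EQUIVALENT to its companion-free
form `SkewnessNonGenerationCF` (the companion `sch'` is always available by the construction of the
route's `closes`), and `¬ K2 ↔ SkewedGappedScheme`: any refutation must exhibit a weakly coupled,
uniformly gapped `SU(2)` lattice scheme with an RP window and a non-vanishing self-normalised
skewness on one disjoint compactly supported triple — an interacting gapped continuum limit, whose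
lattice input `HasLatticeMassGap` at `β_k → ∞` is not constructible in the tree.  The two `Prop`s
are hypotheses/normal forms of this negative analysis, deliberately untagged (not literature facts).
-/

noncomputable section

open scoped SchwartzMap Topology BigOperators
open MeasureTheory Filter Set
open Literature.MathematicalPhysics.AQFT Literature.MathematicalPhysics.QuantumLattice
open Literature.MathematicalPhysics.QuantumFieldTheory
open Summit.QuantumFields.YangMills.Theorems.SelfNormalisedSkewness.Negative

namespace Summit.QuantumFields.YangMills.Theorems.SkewnessNonGeneration.Negative

/-! ## (c) The companion-free form and what a refutation must exhibit -/

section CompanionFree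

open Summit.QuantumFields.YangMills.Theses.BoundedSkewnessRunning

/-- **K2 with the companion deleted** (`CF`): along every weakly coupled, gapped `SU(2)` scheme with
an RP window at an admissible `u`, the self-normalised skewness of `tr F²` dies on every compactly
supported pairwise-disjoint triple.  (This says: a gapped continuum limit reached this way has a
GAUSSIAN curvature three-point function.) -/
def SkewnessNonGenerationCF : Prop :=
  ∀ (r : LatticeRep (Matrix.specialUnitaryGroup (Fin 2) ℂ)) (sch : SpeciesScheme (YMSpecies (Matrix.specialUnitaryGroup (Fin 2) ℂ))) (u : 𝓢(E4, ℝ)) (M Δ : ℝ),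
    sch.HasWeakCouplingLimit → 0 < Δ → HasLatticeMassGap r sch Δ →
    HasCompactSupport (u : E4 → ℝ) → tsupport (u : E4 → ℝ) ⊆ {y : E4 | y 0 < 0} →
    (∀ᶠ k in atTop, cruxT r sch u k ≤ M * cruxT r sch (timeShiftTest 4 (-1) u) k) →
    ∀ (f g h : 𝓢(E4, ℝ)), HasCompactSupport (f : E4 → ℝ) → HasCompactSupport (g : E4 → ℝ) →
      HasCompactSupport (h : E4 → ℝ) → Disjoint (tsupport (f : E4 → ℝ)) (tsupport (g : E4 → ℝ)) →
      Disjoint (tsupport (f : E4 → ℝ)) (tsupport (h : E4 → ℝ)) →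
      Disjoint (tsupport (g : E4 → ℝ)) (tsupport (h : E4 → ℝ)) →
      Tendsto (cruxKappa3 r sch u f g h) atTop (𝓝 0)

/-- `CF ⇒ K2` (the companion hypotheses are simply not used). [folklore] -/
theorem skewnessNonGeneration_of_CF (hCF : SkewnessNonGenerationCF) : SkewnessNonGeneration := by
  intro κ _ r sch sch' u M Δ hw hΔ hgap huc hup hwin _ _ _ _ _ f g h hf hg hh hfg hfh hgh
  exact hCF r sch u M Δ hw hΔ hgap huc hup hwin f g h hf hg hh hfg hfh hgh

/-- `K1 ⇒ K2 ⇒ CF`: under K1 the companion always exists (`a'_k = max (a_k, β_k^{-κ})`, verbatim the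
construction of the route's `closes`), so K2 hands back CF. [folklore] -/
theorem CF_of_skewnessNonGeneration (hK1 : UVSkewnessExtinction) (hK2 : SkewnessNonGeneration) :
    SkewnessNonGenerationCF := by
  intro r sch u M Δ hw hΔ hgap huc hup hwin f g h hf hg hh hfg hfh hgh
  obtain ⟨κ, hκ, hK1⟩ := hK1
  have hβ : Tendsto sch.β atTop atTop := hw
  have hβκ : Tendsto (fun k => (sch.β k) ^ κ) atTop atTop :=
    (Filter.tendsto_pow_atTop (by omega)).comp hβ
  let sch' : SpeciesScheme (YMSpecies (Matrix.specialUnitaryGroup (Fin 2) ℂ)) :=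
    { sch with
      a := fun k => max (sch.a k) ((sch.β k) ^ κ)⁻¹
      a_pos := fun k => lt_max_of_lt_left (sch.a_pos k)
      tendsto_a := by
        have h := sch.tendsto_a.max (tendsto_inv_atTop_zero.comp hβκ)
        rw [max_self] at h
        refine h.congr (fun k => ?_)
        simp only [Function.comp_apply]
      tendsto_L := by
        refine Filter.tendsto_atTop_mono (fun k => ?_) sch.tendsto_L
        exact mul_le_mul_of_nonneg_right (le_max_left _ _) (Nat.cast_nonneg _) }
  have hUV' : ∀ᶠ k in atTop, (sch'.a k)⁻¹ ≤ (sch'.β k) ^ κ := by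
    filter_upwards [hβ.eventually_gt_atTop 0] with k hk
    have hp : 0 < ((sch.β k) ^ κ)⁻¹ := inv_pos.2 (pow_pos hk κ)
    have h1 : ((sch.β k) ^ κ)⁻¹ ≤ max (sch.a k) ((sch.β k) ^ κ)⁻¹ := le_max_right _ _
    have h2 := inv_anti₀ hp h1
    rwa [inv_inv] at h2
  have hw' : sch'.HasWeakCouplingLimit := hw
  exact hK2 κ hκ r sch sch' u M Δ hw hΔ hgap huc hup hwin rfl rfl (fun k => le_max_left _ _) hUV'
    (fun u' f' g' h' hu'c hu'n hf' hg' hh' hfg' hfh' hgh' =>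
      hK1 r sch' u' hw' hUV' hu'c hu'n f' g' h' hf' hg' hh' hfg' hfh' hgh')
    f g h hf hg hh hfg hfh hgh

/-- **K2 ⟺ CF modulo K1.**  The route needs K1 anyway (`closes`), so inside the route K2 carries
exactly the content of CF: the companion `sch'`, `κ`, `a ≤ a'` and the UV window are bookkeeping.
[folklore] -/
theorem skewnessNonGeneration_iff_CF (hK1 : UVSkewnessExtinction) :
    SkewnessNonGeneration ↔ SkewnessNonGenerationCF :=
  ⟨CF_of_skewnessNonGeneration hK1, skewnessNonGeneration_of_CF⟩

/-- **What a refutation of K2 must exhibit** (given K1): a weakly coupled, uniformly gapped `SU(2)`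
scheme with an admissible RP window `u` and ONE compactly supported pairwise-disjoint triple on
which the self-normalised skewness does NOT tend to `0` — i.e. an interacting (non-Gaussian
three-point function of `tr F²`) gapped continuum limit: the AF + confinement consensus, whose
lattice half (`HasLatticeMassGap` at `β_k → ∞`) is the open Clay-type input no witness in the tree
can supply. -/
def SkewedGappedScheme : Prop :=
  ∃ (r : LatticeRep (Matrix.specialUnitaryGroup (Fin 2) ℂ)) (sch : SpeciesScheme (YMSpecies (Matrix.specialUnitaryGroup (Fin 2) ℂ))) (u : 𝓢(E4, ℝ)) (M Δ : ℝ)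
    (f g h : 𝓢(E4, ℝ)),
    sch.HasWeakCouplingLimit ∧ 0 < Δ ∧ HasLatticeMassGap r sch Δ ∧
    HasCompactSupport (u : E4 → ℝ) ∧ tsupport (u : E4 → ℝ) ⊆ {y : E4 | y 0 < 0} ∧
    (∀ᶠ k in atTop, cruxT r sch u k ≤ M * cruxT r sch (timeShiftTest 4 (-1) u) k) ∧
    HasCompactSupport (f : E4 → ℝ) ∧ HasCompactSupport (g : E4 → ℝ) ∧
    HasCompactSupport (h : E4 → ℝ) ∧ Disjoint (tsupport (f : E4 → ℝ)) (tsupport (g : E4 → ℝ)) ∧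
    Disjoint (tsupport (f : E4 → ℝ)) (tsupport (h : E4 → ℝ)) ∧
    Disjoint (tsupport (g : E4 → ℝ)) (tsupport (h : E4 → ℝ)) ∧
    ¬ Tendsto (cruxKappa3 r sch u f g h) atTop (𝓝 0)

/-- `¬ CF ↔ SkewedGappedScheme` (bookkeeping). [folklore] -/
theorem not_CF_iff_skewedGappedScheme : ¬ SkewnessNonGenerationCF ↔ SkewedGappedScheme := by
  constructor
  · intro hn
    by_contra hS
    apply hn
    intro r sch u M Δ hw hΔ hgap huc hup hwin f g h hf hg hh hfg hfh hgh
    by_contra ht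
    exact hS ⟨r, sch, u, M, Δ, f, g, h, hw, hΔ, hgap, huc, hup, hwin, hf, hg, hh, hfg, hfh, hgh, ht⟩
  · rintro ⟨r, sch, u, M, Δ, f, g, h, hw, hΔ, hgap, huc, hup, hwin, hf, hg, hh, hfg, hfh, hgh, ht⟩ hCF
    exact ht (hCF r sch u M Δ hw hΔ hgap huc hup hwin f g h hf hg hh hfg hfh hgh)

/-- **Negative lemma (plain, not `modulo H`)**: a skewed gapped scheme together with K1 refutes K2.
(Equivalently: given K1, `¬ K2 ↔ SkewedGappedScheme`.) [folklore] -/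
theorem skewnessNonGeneration_false_of_skewedGappedScheme (hK1 : UVSkewnessExtinction)
    (hS : SkewedGappedScheme) : ¬ SkewnessNonGeneration := fun hK2 =>
  (not_CF_iff_skewedGappedScheme.mpr hS) (CF_of_skewnessNonGeneration hK1 hK2)

/-- Given K1, refuting K2 is EXACTLY exhibiting a skewed gapped scheme. [folklore] -/
theorem not_skewnessNonGeneration_iff (hK1 : UVSkewnessExtinction) :
    ¬ SkewnessNonGeneration ↔ SkewedGappedScheme := by
  rw [skewnessNonGeneration_iff_CF hK1, not_CF_iff_skewedGappedScheme]

end CompanionFree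

end Summit.QuantumFields.YangMills.Theorems.SkewnessNonGeneration.Negative

end
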